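import Mathlib
import HarnessLib
import Summits.HubbardSuperconductivity.HubbardSuperconductivity.Theorems.KLProgrammeKLRegimeTwoVolumeDefectLimitTower

/-!
# Route `KLProgramme` — crux K3, VL child `KLRegimeVolumeLimitV17F2` (stmt-HubbardSuperconductivity-20440), blueprint v5 M5a: THE LIMIT SPINE OVER A FAMILY OF
# INSTANCES — uniform-in-instance termwise convergence of the defect tower (seat hubbard-kl-k3c4-p1 g12; `--supports` 20440)

`tendsto_defectTower_zero` (p558015) runs on number sequences `E j k L`.  The model tower's defect at scale `j`, degree `k`, coarse volume `L` is a FAMILY of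
numbers indexed by the instances `i ∈ Inst L` = (multiplier `b` of the fine volume `L″ = bL`, Matsubara cutoff `M ≥ M₀(L,b)`, deep pin `w`), and the GLUED text
of the VL stub (k3c5-p3's door p582498 / its source-pair twin) asks for a bound `δ(L) → 0` UNIFORM in the instance.  This file lifts the spine to that setting
with `E j k L := ⨆_{i ∈ Inst L} D j k L i` (`Real.iSup`; `0` on an empty instance type): hypotheses = the per-instance STEP bound in linear form, valid for EVERY
nonnegative majorant of the scale-`j` defects over all instances (exactly what `…SrcSectorScaleSuccMinS` delivers, its `Ej` being any bound), instance-uniform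
domination `D j k L i ≤ Ē j k`, instance-uniform convergence at scale `0` and in degree `0`, instance-free sources; conclusion = for every scale, degree and
`η > 0`, eventually in `L`, `D j k L i ≤ η` for ALL instances `i`.

* `iSup_le_of_forall_le'`, `le_iSup_inst`, `iSup_nonneg_inst` — bookkeeping of `⨆` over a possibly empty instance type;
* **`defectSup_eventually_le`** — the displayed statement.

Pure real analysis; no definition (the instance types, defects and sources are the user's).
-/

noncomputable section

namespace Summit.HubbardSuperconductivity.HubbardSuperconductivity.Theorems.TwoVolumeDefect

set_option linter.dupNamespace false -- summit = problem name (single-conjunct summit), D-0017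

open Finset Filter Topology Literature.MathematicalPhysics.QuantumLattice

/-- `⨆ i, f i ≤ B` from a pointwise bound and `0 ≤ B` (the empty case). [folklore] -/
theorem iSup_le_of_forall_le' {ι : Type*} {f : ι → ℝ} {B : ℝ} (hB : 0 ≤ B) (h : ∀ i, f i ≤ B) : (⨆ i, f i) ≤ B := by
  rcases isEmpty_or_nonempty ι with hι | hι
  · rw [Real.iSup_of_isEmpty]; exact hB
  · exact ciSup_le h

/-- `f i ≤ ⨆ i, f i` under a uniform bound. [folklore] -/
theorem le_iSup_inst {ι : Type*} {f : ι → ℝ} {B : ℝ} (h : ∀ i, f i ≤ B) (i : ι) : f i ≤ ⨆ i, f i :=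
  le_ciSup ⟨B, by rintro _ ⟨j, rfl⟩; exact h j⟩ i

/-- `0 ≤ ⨆ i, f i` for a nonnegative family. [folklore] -/
theorem iSup_nonneg_inst {ι : Type*} {f : ι → ℝ} (h : ∀ i, 0 ≤ f i) : 0 ≤ ⨆ i, f i := Real.iSup_nonneg h

/-- A nonnegative sequence that is eventually `≤ η` for every `η > 0` tends to `0`. [folklore] -/
theorem tendsto_zero_of_forall_eventually_le {E : ℕ → ℝ} (h0 : ∀ L, 0 ≤ E L) (h : ∀ η : ℝ, 0 < η → ∀ᶠ L in atTop, E L ≤ η) :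
    Tendsto E atTop (𝓝 0) := by
  rw [Metric.tendsto_atTop]
  intro η hη
  obtain ⟨L₀, hL₀⟩ := (h (η / 2) (half_pos hη)).exists_forall_of_atTop
  refine ⟨L₀, fun L hL => ?_⟩
  rw [Real.dist_eq, sub_zero, abs_of_nonneg (h0 L)]
  exact (hL₀ L hL).trans_lt (half_lt_self hη)

/-- **THE DEFECT TOWER OVER A FAMILY OF INSTANCES TENDS TO ZERO UNIFORMLY IN THE INSTANCE, SCALE BY SCALE.**  Instances `Inst L` (any types), defects
`D j k L i ≥ 0`; instance-uniform domination `D j k L i ≤ Ē j k` (`Ē ≥ 0`); at scale `0` and in degree `0` instance-uniform convergence; instance-free sources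
`τ_j, Te_j, T_j → 0`, `Nfar_j → 0`, `φRd_j, Rf_j → +∞`; the dominating transfer series summable; and the STEP in linear form at every instance of scale `j+1`,
for EVERY nonnegative instance-uniform majorant `Ej` of the scale-`j` defects.  THEN for every `j ≤ n⋆`, `k`, `η > 0`: eventually in `L`, `D j k L i ≤ η` for all
instances `i`. [folklore: Tannery's theorem per scale, `⨆` over instances] -/
theorem defectSup_eventually_le (nstar : ℕ) (Inst : ℕ → Type*) (D : ℕ → ℕ → (L : ℕ) → Inst L → ℝ) (Ebar N ND : ℕ → ℕ → ℝ) (a τbar : ℕ → ℝ)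
    (Nfarbar : ℕ → ℕ → ℝ) (τ Te T φRd Rf : ℕ → ℕ → ℝ) (Nfar : ℕ → ℕ → ℕ → ℝ) (KE KD KTe KT KRf : ℕ → ℕ → ℝ) (κ ρ : ℕ → ℝ)
    (hκ : ∀ j, 0 ≤ κ j) (hρ : ∀ j, 0 ≤ ρ j) (ha : ∀ j, 0 ≤ a j) (hN : ∀ j k, 0 ≤ N j k) (hND : ∀ j k, 0 ≤ ND j k)
    (hDnn : ∀ j k L i, 0 ≤ D j k L i) (hEbar0 : ∀ j k, 0 ≤ Ebar j k) (hDbd : ∀ j k L i, D j k L i ≤ Ebar j k)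
    (hτnn : ∀ j L, 0 ≤ τ j L) (hτbd : ∀ j L, τ j L ≤ τbar j) (hτ : ∀ j, Tendsto (τ j) atTop (𝓝 0))
    (hNfnn : ∀ j k L, 0 ≤ Nfar j k L) (hNfbd : ∀ j k L, Nfar j k L ≤ Nfarbar j k) (hNf : ∀ j k, Tendsto (Nfar j k) atTop (𝓝 0))
    (hTe : ∀ j, Tendsto (Te j) atTop (𝓝 0)) (hT : ∀ j, Tendsto (T j) atTop (𝓝 0))
    (hφ : ∀ j, Tendsto (φRd j) atTop atTop) (hRf : ∀ j, Tendsto (Rf j) atTop atTop)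
    -- signs (for the empty-instance case of the supremum): nonnegative coefficients and sources
    (hK0 : ∀ j n, 0 ≤ KE j n ∧ 0 ≤ KD j n ∧ 0 ≤ KTe j n ∧ 0 ≤ KT j n ∧ 0 ≤ KRf j n)
    (hsrc0 : ∀ j L, 0 ≤ Te j L ∧ 0 ≤ T j L ∧ 0 ≤ φRd j L ∧ 0 ≤ Rf j L)
    (hsum : ∀ j, Summable fun m : ℕ => (Real.exp 2 * (κ j + ρ j)) ^ (2 * m) *
      (a j ^ (2 * m - 1) * (a j * Ebar j (2 * m) + τbar j * ND j (2 * m)) +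
        (2 * a j ^ (2 * m - 1) * τbar j * N j (2 * m) + ((2 * m - 1 : ℕ) : ℝ) * a j ^ (2 * m - 1) * (5 * τbar j * N j (2 * m) + 2 * a j * Nfarbar j (2 * m)))))
    (h0 : ∀ k, ∀ η : ℝ, 0 < η → ∀ᶠ L in atTop, ∀ i : Inst L, D 0 k L i ≤ η)
    (hdeg0 : ∀ j, ∀ η : ℝ, 0 < η → ∀ᶠ L in atTop, ∀ i : Inst L, D (j + 1) 0 L i ≤ η)
    (hrec : ∀ j, j < nstar → ∀ n : ℕ, ∀ᶠ L in atTop, ∀ (Ej : ℕ → ℝ), (∀ k, 0 ≤ Ej k) → (∀ k (i' : Inst L), D j k L i' ≤ Ej k) → ∀ i : Inst L,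
      D (j + 1) (n + 1) L i ≤
        KE j n * (∑' m : ℕ, (Real.exp 2 * (κ j + ρ j)) ^ (2 * m) *
            (a j ^ (2 * m - 1) * (a j * Ej (2 * m) + τ j L * ND j (2 * m)) +
              (2 * a j ^ (2 * m - 1) * τ j L * N j (2 * m) +
                ((2 * m - 1 : ℕ) : ℝ) * a j ^ (2 * m - 1) * (5 * τ j L * N j (2 * m) + 2 * a j * Nfar j (2 * m) L)))) +
          KD j n * (φRd j L)⁻¹ + KTe j n * Te j L + KT j n * T j L + KRf j n * (Rf j L)⁻¹) :
    ∀ j, j ≤ nstar → ∀ (k : ℕ) (η : ℝ), 0 < η → ∀ᶠ L in atTop, ∀ i : Inst L, D j k L i ≤ η := by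
  -- the instance supremum
  set E : ℕ → ℕ → ℕ → ℝ := fun j k L => ⨆ i : Inst L, D j k L i with hEdef
  have hEle : ∀ j k L (i : Inst L), D j k L i ≤ E j k L := fun j k L i => le_iSup_inst (hDbd j k L) i
  have hEnn : ∀ j k L, 0 ≤ E j k L := fun j k L => iSup_nonneg_inst fun i => hDnn j k L i
  have hEbd : ∀ j k L, E j k L ≤ Ebar j k := fun j k L => iSup_le_of_forall_le' (hEbar0 j k) fun i => hDbd j k L i
  have hEev : ∀ j k, (∀ η : ℝ, 0 < η → ∀ᶠ L in atTop, ∀ i : Inst L, D j k L i ≤ η) → Tendsto (E j k) atTop (𝓝 0) := by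
    intro j k h
    refine tendsto_zero_of_forall_eventually_le (hEnn j k) fun η hη => ?_
    filter_upwards [h η hη] with L hL
    exact iSup_le_of_forall_le' hη.le hL
  -- the spine on the suprema
  have hsp := tendsto_defectTower_zero nstar E Ebar N ND a τbar Nfarbar τ Te T φRd Rf Nfar KE KD KTe KT KRf κ ρ hκ hρ ha hN hND hEnn hEbd hτnn hτbd hτ
    hNfnn hNfbd hNf hTe hT hφ hRf hsum (fun k => hEev 0 k (h0 k)) (fun j => hEev (j + 1) 0 (hdeg0 j)) ?_
  · intro j hj k η hη
    have ht := hsp j hj k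
    rw [Metric.tendsto_atTop] at ht
    obtain ⟨L₀, hL₀⟩ := ht η hη
    filter_upwards [eventually_ge_atTop L₀] with L hL i
    have h := hL₀ L hL
    rw [Real.dist_eq, sub_zero, abs_of_nonneg (hEnn j k L)] at h
    exact (hEle j k L i).trans h.le
  · intro j hj n
    filter_upwards [hrec j hj n] with L hL
    refine iSup_le_of_forall_le' ?_ fun i => hL (fun k => E j k L) (fun k => hEnn j k L) (fun k i' => hEle j k L i') i
    -- the right-hand side is nonnegative
    obtain ⟨hKE, hKD, hKTe, hKT, hKRf⟩ := hK0 j n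
    obtain ⟨hTe0, hT0, hφ0, hRf0⟩ := hsrc0 j L
    refine add_nonneg (add_nonneg (add_nonneg (add_nonneg (mul_nonneg hKE (tsum_nonneg fun m => ?_)) (mul_nonneg hKD (inv_nonneg.2 hφ0)))
      (mul_nonneg hKTe hTe0)) (mul_nonneg hKT hT0)) (mul_nonneg hKRf (inv_nonneg.2 hRf0))
    have hw : 0 ≤ (Real.exp 2 * (κ j + ρ j)) ^ (2 * m) := pow_nonneg (mul_nonneg (Real.exp_pos 2).le (add_nonneg (hκ j) (hρ j))) _
    exact mul_nonneg hw (transferBound_nonneg (2 * m - 1) (ha j) (hN j _) (hND j _) (hEnn j _ L) (hτnn j L) (hNfnn j _ L))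

/-- **The same spine, the STEP required only for BOUNDED majorants** (`Ej ≤ Ē j`): the form the model step delivers (its field-weighted norms are
replaced by volume-free series, which converge only under the domination). [folklore: Tannery's theorem per scale, `⨆` over instances] -/
theorem defectSup_eventually_le_of_bdd (nstar : ℕ) (Inst : ℕ → Type*) (D : ℕ → ℕ → (L : ℕ) → Inst L → ℝ) (Ebar N ND : ℕ → ℕ → ℝ) (a τbar : ℕ → ℝ)
    (Nfarbar : ℕ → ℕ → ℝ) (τ Te T φRd Rf : ℕ → ℕ → ℝ) (Nfar : ℕ → ℕ → ℕ → ℝ) (KE KD KTe KT KRf : ℕ → ℕ → ℝ) (κ ρ : ℕ → ℝ)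
    (hκ : ∀ j, 0 ≤ κ j) (hρ : ∀ j, 0 ≤ ρ j) (ha : ∀ j, 0 ≤ a j) (hN : ∀ j k, 0 ≤ N j k) (hND : ∀ j k, 0 ≤ ND j k)
    (hDnn : ∀ j k L i, 0 ≤ D j k L i) (hEbar0 : ∀ j k, 0 ≤ Ebar j k) (hDbd : ∀ j k L i, D j k L i ≤ Ebar j k)
    (hτnn : ∀ j L, 0 ≤ τ j L) (hτbd : ∀ j L, τ j L ≤ τbar j) (hτ : ∀ j, Tendsto (τ j) atTop (𝓝 0))
    (hNfnn : ∀ j k L, 0 ≤ Nfar j k L) (hNfbd : ∀ j k L, Nfar j k L ≤ Nfarbar j k) (hNf : ∀ j k, Tendsto (Nfar j k) atTop (𝓝 0))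
    (hTe : ∀ j, Tendsto (Te j) atTop (𝓝 0)) (hT : ∀ j, Tendsto (T j) atTop (𝓝 0))
    (hφ : ∀ j, Tendsto (φRd j) atTop atTop) (hRf : ∀ j, Tendsto (Rf j) atTop atTop)
    -- signs (for the empty-instance case of the supremum): nonnegative coefficients and sources
    (hK0 : ∀ j n, 0 ≤ KE j n ∧ 0 ≤ KD j n ∧ 0 ≤ KTe j n ∧ 0 ≤ KT j n ∧ 0 ≤ KRf j n)
    (hsrc0 : ∀ j L, 0 ≤ Te j L ∧ 0 ≤ T j L ∧ 0 ≤ φRd j L ∧ 0 ≤ Rf j L)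
    (hsum : ∀ j, Summable fun m : ℕ => (Real.exp 2 * (κ j + ρ j)) ^ (2 * m) *
      (a j ^ (2 * m - 1) * (a j * Ebar j (2 * m) + τbar j * ND j (2 * m)) +
        (2 * a j ^ (2 * m - 1) * τbar j * N j (2 * m) + ((2 * m - 1 : ℕ) : ℝ) * a j ^ (2 * m - 1) * (5 * τbar j * N j (2 * m) + 2 * a j * Nfarbar j (2 * m)))))
    (h0 : ∀ k, ∀ η : ℝ, 0 < η → ∀ᶠ L in atTop, ∀ i : Inst L, D 0 k L i ≤ η)
    (hdeg0 : ∀ j, ∀ η : ℝ, 0 < η → ∀ᶠ L in atTop, ∀ i : Inst L, D (j + 1) 0 L i ≤ η)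
    (hrec : ∀ j, j < nstar → ∀ n : ℕ, ∀ᶠ L in atTop, ∀ (Ej : ℕ → ℝ), (∀ k, 0 ≤ Ej k) → (∀ k, Ej k ≤ Ebar j k) → (∀ k (i' : Inst L), D j k L i' ≤ Ej k) →
      ∀ i : Inst L,
      D (j + 1) (n + 1) L i ≤
        KE j n * (∑' m : ℕ, (Real.exp 2 * (κ j + ρ j)) ^ (2 * m) *
            (a j ^ (2 * m - 1) * (a j * Ej (2 * m) + τ j L * ND j (2 * m)) +
              (2 * a j ^ (2 * m - 1) * τ j L * N j (2 * m) +
                ((2 * m - 1 : ℕ) : ℝ) * a j ^ (2 * m - 1) * (5 * τ j L * N j (2 * m) + 2 * a j * Nfar j (2 * m) L)))) +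
          KD j n * (φRd j L)⁻¹ + KTe j n * Te j L + KT j n * T j L + KRf j n * (Rf j L)⁻¹) :
    ∀ j, j ≤ nstar → ∀ (k : ℕ) (η : ℝ), 0 < η → ∀ᶠ L in atTop, ∀ i : Inst L, D j k L i ≤ η := by
  -- the instance supremum
  set E : ℕ → ℕ → ℕ → ℝ := fun j k L => ⨆ i : Inst L, D j k L i with hEdef
  have hEle : ∀ j k L (i : Inst L), D j k L i ≤ E j k L := fun j k L i => le_iSup_inst (hDbd j k L) i
  have hEnn : ∀ j k L, 0 ≤ E j k L := fun j k L => iSup_nonneg_inst fun i => hDnn j k L i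
  have hEbd : ∀ j k L, E j k L ≤ Ebar j k := fun j k L => iSup_le_of_forall_le' (hEbar0 j k) fun i => hDbd j k L i
  have hEev : ∀ j k, (∀ η : ℝ, 0 < η → ∀ᶠ L in atTop, ∀ i : Inst L, D j k L i ≤ η) → Tendsto (E j k) atTop (𝓝 0) := by
    intro j k h
    refine tendsto_zero_of_forall_eventually_le (hEnn j k) fun η hη => ?_
    filter_upwards [h η hη] with L hL
    exact iSup_le_of_forall_le' hη.le hL
  -- the spine on the suprema
  have hsp := tendsto_defectTower_zero nstar E Ebar N ND a τbar Nfarbar τ Te T φRd Rf Nfar KE KD KTe KT KRf κ ρ hκ hρ ha hN hND hEnn hEbd hτnn hτbd hτ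
    hNfnn hNfbd hNf hTe hT hφ hRf hsum (fun k => hEev 0 k (h0 k)) (fun j => hEev (j + 1) 0 (hdeg0 j)) ?_
  · intro j hj k η hη
    have ht := hsp j hj k
    rw [Metric.tendsto_atTop] at ht
    obtain ⟨L₀, hL₀⟩ := ht η hη
    filter_upwards [eventually_ge_atTop L₀] with L hL i
    have h := hL₀ L hL
    rw [Real.dist_eq, sub_zero, abs_of_nonneg (hEnn j k L)] at h
    exact (hEle j k L i).trans h.le
  · intro j hj n
    filter_upwards [hrec j hj n] with L hL
    refine iSup_le_of_forall_le' ?_ fun i => hL (fun k => E j k L) (fun k => hEnn j k L) (fun k => hEbd j k L) (fun k i' => hEle j k L i') i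
    -- the right-hand side is nonnegative
    obtain ⟨hKE, hKD, hKTe, hKT, hKRf⟩ := hK0 j n
    obtain ⟨hTe0, hT0, hφ0, hRf0⟩ := hsrc0 j L
    refine add_nonneg (add_nonneg (add_nonneg (add_nonneg (mul_nonneg hKE (tsum_nonneg fun m => ?_)) (mul_nonneg hKD (inv_nonneg.2 hφ0)))
      (mul_nonneg hKTe hTe0)) (mul_nonneg hKT hT0)) (mul_nonneg hKRf (inv_nonneg.2 hRf0))
    have hw : 0 ≤ (Real.exp 2 * (κ j + ρ j)) ^ (2 * m) := pow_nonneg (mul_nonneg (Real.exp_pos 2).le (add_nonneg (hκ j) (hρ j))) _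
    exact mul_nonneg hw (transferBound_nonneg (2 * m - 1) (ha j) (hN j _) (hND j _) (hEnn j _ L) (hτnn j L) (hNfnn j _ L))

/-- **The same spine over SCALE- AND DEGREE-DEPENDENT instance types** `Inst j k L` (the model's instances carry the pin, a label of a type that depends on the
scale, in a slot `p : Fin k`): defects `D j k L i ≥ 0` dominated instance-uniformly by `Ē j k`, the STEP in linear form for bounded majorants, the same sources;
conclusion: for every `j ≤ n⋆`, `k`, `η > 0`, eventually in `L`, `D j k L i ≤ η` for all `i : Inst j k L`. [folklore: Tannery's theorem per scale, `⨆` over instances] -/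
theorem defectSup_eventually_le_of_bdd_dep (nstar : ℕ) (Inst : ℕ → ℕ → ℕ → Type*) (D : (j k L : ℕ) → Inst j k L → ℝ) (Ebar N ND : ℕ → ℕ → ℝ)
    (a τbar : ℕ → ℝ) (Nfarbar : ℕ → ℕ → ℝ) (τ Te T φRd Rf : ℕ → ℕ → ℝ) (Nfar : ℕ → ℕ → ℕ → ℝ) (KE KD KTe KT KRf : ℕ → ℕ → ℝ) (κ ρ : ℕ → ℝ)
    (hκ : ∀ j, 0 ≤ κ j) (hρ : ∀ j, 0 ≤ ρ j) (ha : ∀ j, 0 ≤ a j) (hN : ∀ j k, 0 ≤ N j k) (hND : ∀ j k, 0 ≤ ND j k)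
    (hDnn : ∀ j k L i, 0 ≤ D j k L i) (hEbar0 : ∀ j k, 0 ≤ Ebar j k) (hDbd : ∀ j k L i, D j k L i ≤ Ebar j k)
    (hτnn : ∀ j L, 0 ≤ τ j L) (hτbd : ∀ j L, τ j L ≤ τbar j) (hτ : ∀ j, Tendsto (τ j) atTop (𝓝 0))
    (hNfnn : ∀ j k L, 0 ≤ Nfar j k L) (hNfbd : ∀ j k L, Nfar j k L ≤ Nfarbar j k) (hNf : ∀ j k, Tendsto (Nfar j k) atTop (𝓝 0))
    (hTe : ∀ j, Tendsto (Te j) atTop (𝓝 0)) (hT : ∀ j, Tendsto (T j) atTop (𝓝 0))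
    (hφ : ∀ j, Tendsto (φRd j) atTop atTop) (hRf : ∀ j, Tendsto (Rf j) atTop atTop)
    -- signs (for the empty-instance case of the supremum): nonnegative coefficients and sources
    (hK0 : ∀ j n, 0 ≤ KE j n ∧ 0 ≤ KD j n ∧ 0 ≤ KTe j n ∧ 0 ≤ KT j n ∧ 0 ≤ KRf j n)
    (hsrc0 : ∀ j L, 0 ≤ Te j L ∧ 0 ≤ T j L ∧ 0 ≤ φRd j L ∧ 0 ≤ Rf j L)
    (hsum : ∀ j, Summable fun m : ℕ => (Real.exp 2 * (κ j + ρ j)) ^ (2 * m) *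
      (a j ^ (2 * m - 1) * (a j * Ebar j (2 * m) + τbar j * ND j (2 * m)) +
        (2 * a j ^ (2 * m - 1) * τbar j * N j (2 * m) + ((2 * m - 1 : ℕ) : ℝ) * a j ^ (2 * m - 1) * (5 * τbar j * N j (2 * m) + 2 * a j * Nfarbar j (2 * m)))))
    (h0 : ∀ k, ∀ η : ℝ, 0 < η → ∀ᶠ L in atTop, ∀ i : Inst 0 k L, D 0 k L i ≤ η)
    (hdeg0 : ∀ j, ∀ η : ℝ, 0 < η → ∀ᶠ L in atTop, ∀ i : Inst (j + 1) 0 L, D (j + 1) 0 L i ≤ η)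
    (hrec : ∀ j, j < nstar → ∀ n : ℕ, ∀ᶠ L in atTop, ∀ (Ej : ℕ → ℝ), (∀ k, 0 ≤ Ej k) → (∀ k, Ej k ≤ Ebar j k) →
      (∀ k (i' : Inst j k L), D j k L i' ≤ Ej k) → ∀ i : Inst (j + 1) (n + 1) L,
      D (j + 1) (n + 1) L i ≤
        KE j n * (∑' m : ℕ, (Real.exp 2 * (κ j + ρ j)) ^ (2 * m) *
            (a j ^ (2 * m - 1) * (a j * Ej (2 * m) + τ j L * ND j (2 * m)) +
              (2 * a j ^ (2 * m - 1) * τ j L * N j (2 * m) +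
                ((2 * m - 1 : ℕ) : ℝ) * a j ^ (2 * m - 1) * (5 * τ j L * N j (2 * m) + 2 * a j * Nfar j (2 * m) L)))) +
          KD j n * (φRd j L)⁻¹ + KTe j n * Te j L + KT j n * T j L + KRf j n * (Rf j L)⁻¹) :
    ∀ j, j ≤ nstar → ∀ (k : ℕ) (η : ℝ), 0 < η → ∀ᶠ L in atTop, ∀ i : Inst j k L, D j k L i ≤ η := by
  -- the instance supremum
  set E : ℕ → ℕ → ℕ → ℝ := fun j k L => ⨆ i : Inst j k L, D j k L i with hEdef
  have hEle : ∀ j k L (i : Inst j k L), D j k L i ≤ E j k L := fun j k L i => le_iSup_inst (hDbd j k L) i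
  have hEnn : ∀ j k L, 0 ≤ E j k L := fun j k L => iSup_nonneg_inst fun i => hDnn j k L i
  have hEbd : ∀ j k L, E j k L ≤ Ebar j k := fun j k L => iSup_le_of_forall_le' (hEbar0 j k) fun i => hDbd j k L i
  have hEev : ∀ j k, (∀ η : ℝ, 0 < η → ∀ᶠ L in atTop, ∀ i : Inst j k L, D j k L i ≤ η) → Tendsto (E j k) atTop (𝓝 0) := by
    intro j k h
    refine tendsto_zero_of_forall_eventually_le (hEnn j k) fun η hη => ?_
    filter_upwards [h η hη] with L hL
    exact iSup_le_of_forall_le' hη.le hL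
  -- the spine on the suprema
  have hsp := tendsto_defectTower_zero nstar E Ebar N ND a τbar Nfarbar τ Te T φRd Rf Nfar KE KD KTe KT KRf κ ρ hκ hρ ha hN hND hEnn hEbd hτnn hτbd hτ
    hNfnn hNfbd hNf hTe hT hφ hRf hsum (fun k => hEev 0 k (h0 k)) (fun j => hEev (j + 1) 0 (hdeg0 j)) ?_
  · intro j hj k η hη
    have ht := hsp j hj k
    rw [Metric.tendsto_atTop] at ht
    obtain ⟨L₀, hL₀⟩ := ht η hη
    filter_upwards [eventually_ge_atTop L₀] with L hL i
    have h := hL₀ L hL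
    rw [Real.dist_eq, sub_zero, abs_of_nonneg (hEnn j k L)] at h
    exact (hEle j k L i).trans h.le
  · intro j hj n
    filter_upwards [hrec j hj n] with L hL
    refine iSup_le_of_forall_le' ?_ fun i => hL (fun k => E j k L) (fun k => hEnn j k L) (fun k => hEbd j k L) (fun k i' => hEle j k L i') i
    -- the right-hand side is nonnegative
    obtain ⟨hKE, hKD, hKTe, hKT, hKRf⟩ := hK0 j n
    obtain ⟨hTe0, hT0, hφ0, hRf0⟩ := hsrc0 j L
    refine add_nonneg (add_nonneg (add_nonneg (add_nonneg (mul_nonneg hKE (tsum_nonneg fun m => ?_)) (mul_nonneg hKD (inv_nonneg.2 hφ0)))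
      (mul_nonneg hKTe hTe0)) (mul_nonneg hKT hT0)) (mul_nonneg hKRf (inv_nonneg.2 hRf0))
    have hw : 0 ≤ (Real.exp 2 * (κ j + ρ j)) ^ (2 * m) := pow_nonneg (mul_nonneg (Real.exp_pos 2).le (add_nonneg (hκ j) (hρ j))) _
    exact mul_nonneg hw (transferBound_nonneg (2 * m - 1) (ha j) (hN j _) (hND j _) (hEnn j _ L) (hτnn j L) (hNfnn j _ L))

end Summit.HubbardSuperconductivity.HubbardSuperconductivity.Theorems.TwoVolumeDefect

end
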